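import Summits.BirchSwinnertonDyer.BirchSwinnertonDyer.Theorems.ClassRecordThreeCornerAtThreeShimuraFamilyKummerPlaces
import Summits.BirchSwinnertonDyer.BirchSwinnertonDyer.Theorems.ClassRecordThreeCornerAtThreeShimuraFamilySign
import Summits.BirchSwinnertonDyer.BirchSwinnertonDyer.Theorems.ClassRecordThreeCornerAtThreeShimuraFamilyKeyRelation
import Summits.BirchSwinnertonDyer.BirchSwinnertonDyer.Theorems.ClassRecordThreeCornerAtThreeShimuraFamilyStringent
import Summits.BirchSwinnertonDyer.BirchSwinnertonDyer.Theorems.ClassRecordThreeCornerAtThreeShimuraFamilyCoherentData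
import Summits.BirchSwinnertonDyer.BirchSwinnertonDyer.Theorems.ClassRecordThreeCornerAtThreeShimuraFamilyLabels
import HarnessLib

/-!
# THE FAMILY-SPECIFIC LOCAL SUPPLY OF THE JETCHEV WALK ON A SHIMURA FRAME, FROM THE LABELS ONLY: for a labelled family `ys` (`LabelsAt` + `LabelB6`
# at the split bad primes) there are COHERENT generalised Kolyvagin data `d m` (`(d m).y = ys m`) at every divisor of a square-free Kolyvagin top level,
# with admissible `E(K[m]) ⊆ E(K̄)`, whose classes `c_M(m) = (d m).kolyvaginClass` satisfy Gross 6.2 (1) at every `v ∤ m`, Gross 5.4 (sign), McCallum 4.4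
# (key relation) and Jetchev 4.9 (stringent at the split bad places) — the ASSEMBLY of this seat's g8 bricks (cell `bsd-stepL`, seat
# `bsd-stepL-corner3-p2` g8 = WIDTH-LEVER lane B; `--supports stmt-BirchSwinnertonDyer-21420 --as helper`)

WHY (HOME/corner3/g8/CORNER3-G8.md §4). The (P2) walk for the port target `ShimuraWalk.LevelSupplyAtThreeB6` (tam3-p1's in-place re-keyed
`…_family` theorems) consumes, for the data `D s : JET.KolyvaginFamilyData` of the labelled CM family of `X_{N⁺,N⁻}`, the family-specific local
facts: admissibility (`hA`), Kummer membership off the conductor (`hselmer`'s Kummer part), the sign (`eb`∕`hκsign`), the key relation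
(`h47`∕`h44c`) and the stringent membership at the carrier (`h49`). THIS FILE delivers all of them AT ONCE from the two label predicates of the targets:
`familySupply_of_labels` — inputs: the frame clauses `hin` (inert set `S`) ∕ `hsp` (the other bad primes split), `E[p]` irreducible, `p` odd, no
`p`-power torsion over the ring class fields of conductor prime to `p` (`htor`, x11b3's `NoTorsionIrr` on the frame), a square-free top level `n`
on Kolyvagin primes of Gross depth `M ≥ 1`, `LabelsAt W N K ι y ys ε`, `LabelB6 ι W N (N.primeFactors.filter (· ∉ S)) ys`, a non-trivial `c ∈ Aut(K)`;
output: `∃ d : (m ∣ n) → KolyvaginFamilyData W K ι m` COHERENT with `(d m).y = ys m`, admissible at `p^M`, and the four local facts for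
`(d m hm).kolyvaginClass hp M` (receptacle exponent `n′ = #E(ℚ)_tors`). Proof: `exists_coherent_familyData_y_eq` (p600796) + `familyLabels_of_labelsAt` ∕
`familyReceptacle_of_labelB6` (`…ShimuraFamilyLabels`) + the bricks p600152 ∕ p600503 ∕ p601020 ∕ p601311; admissibility from `htor` along the Galois
dictionary of the level-data package. HONEST FRAMING: one theorem + one admissibility lemma (no definition, no named fact, no `sorry`); CONDITIONAL on
the labels (hypotheses of the port targets — (B6) beyond print for `X_{N⁺,N⁻}`); nothing about any Heegner ∕ CM point is constructed; no stub closes;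
BSD is not proved by any of this; T7. References: [cite: GrossLMS1991, §3 Prop. 3.7, §4 (4.1), Lemma 4.3, §5 Prop. 5.4, §6 Prop. 6.2 (1)]
[cite: McCallumLMS1991, §4 Prop. 4.4, Lemma 4.3] [cite: Jetchev2008, Prop. 4.9] [cite: Howard2004Duke, Lemma 3.1.5].
presearch: not applicable (assembly of this seat's tree theorems); `lean search 'familySupply_of_labels'` → none.
-/

set_option autoImplicit false
set_option linter.dupNamespace false

noncomputable section

open scoped Classical
open scoped AddSubgroup

namespace Summit.BirchSwinnertonDyer.BirchSwinnertonDyer.Theorems.ShimuraWalk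

open WeierstrassCurve Field NumberField IsDedekindDomain Finset
  Literature.NumberTheory.EllipticCurves Literature.NumberTheory.GaloisRepresentations
  Literature.NumberTheory.EllipticCurves.KolyvaginCocycle
  Literature.NumberTheory.EllipticCurves.KolyvaginEuler
  Literature.NumberTheory.EllipticCurves.RingClassField
  Literature.NumberTheory.EllipticCurves.ModularForms
  Literature.NumberTheory.EllipticCurves.ShimuraCMFamily
  Summit.BirchSwinnertonDyer.Rank1Residual.X11b Summit.BirchSwinnertonDyer.Rank1Residual.X11b.Three
  Summit.BirchSwinnertonDyer.Rank1Residual.JET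
  Summit.BirchSwinnertonDyer.BirchSwinnertonDyer.Theorems

variable {K : Type} [Field K] [NumberField K] {W : WeierstrassCurve ℚ} {ι : K →+* ℂ}

/-- **Admissibility of `E(emb)(E(K[m])) ⊆ E(K̄)` for a family datum** (Gross Lemma 4.3 ∕ McCallum (5)): `Γ_K`-stable (Galois dictionary of the
level) and `p^M`-torsion-free when `E(K[m])` has no `p`-power torsion (`htor`). [cite: GrossLMS1991, Lemma 4.3] [cite: McCallumLMS1991, §4 (5)] -/
theorem isAdmissible_pointsSubgroup_familyData (hK : IsImaginaryQuadratic K) {m : ℕ}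
    (d : KolyvaginFamilyData W K ι m) {p M : ℕ}
    (htor : ∀ (n' : ℕ) (a : (W.baseChange (ringClassField K ι m)).toAffine.Point), ((p ^ n' : ℕ) : ℤ) • a = 0 → a = 0) :
    IsAdmissible (absoluteGaloisGroup K) d.pointsSubgroup ((p ^ M : ℕ) : ℤ) := by
  let e : ringClassField K ι m →ₐ[K] AlgebraicClosure K := { d.emb with commutes' := d.emb_apply }
  have he : ∀ x, e x = d.emb x := fun _ ↦ rfl
  obtain ⟨π, hπ⟩ := KolyvaginH44.exists_absGaloisRestrict hK ι m e
  refine ⟨fun g a ha ↦ ?_, fun a ha h0 ↦ ?_⟩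
  · obtain ⟨a₀, rfl⟩ := ha
    exact ⟨pointGalHom W (ringClassField K ι m) (π g : ringClassField K ι m ≃ₐ[ℚ] ringClassField K ι m) a₀,
      map_pointGalHom_eq_smul_map W d.emb (fun x ↦ by rw [← he, ← he]; exact hπ g x) _ rfl a₀⟩
  · obtain ⟨a₀, rfl⟩ := ha
    have h1 : d.toGeomPoints (((p ^ M : ℕ) : ℤ) • a₀) = d.toGeomPoints 0 := by rw [map_zsmul, map_zero]; exact h0
    have h2 : ((p ^ M : ℕ) : ℤ) • a₀ = 0 :=
      WeierstrassCurve.Affine.Point.map_injective (W' := W) d.emb.toRatAlgHom h1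
    rw [htor M a₀ h2, map_zero]

set_option maxHeartbeats 800000 in
/-- **The family-specific local supply from the labels** (see the module docstring): coherent data with `(d m).y = ys m`, admissibility, and for the
classes `(d m hm).kolyvaginClass hp M`: Gross 6.2 (1) at every finite `v ∤ m`; Gross 5.4 `τ_* c = ε_m • c`; McCallum 4.4 at `λ ∣ ℓ ∣ m`; Jetchev 4.9 at
every bad place `v ∤ m` over a prime `q ∉ S`. [cite: GrossLMS1991, Prop. 6.2 (1), Prop. 5.4, Prop. 3.7] [cite: McCallumLMS1991, Prop. 4.4] [cite: Jetchev2008, Prop. 4.9] -/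
theorem familySupply_of_labels {N : ℕ} [NeZero N] [W.IsElliptic] [W.IsGloballyMinimal]
    (hK : IsImaginaryQuadratic K) (ι : K →+* ℂ) (hN : W.conductorNorm ℤ = N)
    {p M : ℕ} (hp : p.Prime) (hp2 : p ≠ 2) (hM : 1 ≤ M) (Dt : ModularParametrizationData W N)
    [∀ j : ℕ, NumberField (ringClassField K ι j)] (hirr : W.HasIrreducibleModPGaloisRep p)
    {S : Finset ℕ}
    (hin : ∀ ℓ ∈ S, ℓ.Prime ∧ ℓ ∣ N ∧ ¬ ℓ ^ 2 ∣ N ∧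
      ((Ideal.span {(ℓ : ℤ)}).primesOver (𝓞 K)).ncard = 1 ∧ ¬ (ℓ : ℤ) ∣ NumberField.discr K)
    (hsp : ∀ ℓ : ℕ, ℓ.Prime → ℓ ∣ N → ℓ ∉ S → ((Ideal.span {(ℓ : ℤ)}).primesOver (𝓞 K)).ncard = 2)
    (htor : ∀ k : ℕ, k ≠ 0 → ¬ p ∣ k →
      ∀ (n' : ℕ) (a : (W.baseChange (ringClassField K ι k)).toAffine.Point), ((p ^ n' : ℕ) : ℤ) • a = 0 → a = 0)
    {n : ℕ} (hn : Squarefree n)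
    (hKol : ∀ q ∈ n.primeFactors, IsKolyvaginPrime N W K p q ∧ FrobEqFrobInfty W K (p ^ M) q)
    (ys : (m : ℕ) → (W.baseChange (ringClassField K ι m)).toAffine.Point)
    {yK : (W.baseChange K).toAffine.Point} {ε : ℤ} (hL : LabelsAt W N K ι yK ys ε)
    (hB6 : LabelB6 ι W N (N.primeFactors.filter (· ∉ S)) ys)
    {c : K ≃ₐ[ℚ] K} (hc : c ≠ 1) :
    ∃ (d : (m : ℕ) → m ∣ n → KolyvaginFamilyData W K ι m)
      (_ : ∀ (m : ℕ) (hm : m ∣ n), IsAdmissible (absoluteGaloisGroup K) (d m hm).pointsSubgroup ((p ^ M : ℕ) : ℤ)),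
      (∀ (m : ℕ) (hm : m ∣ n), (d m hm).y = ys m) ∧
      -- Gross 6.2 (1) at every finite place off the conductor
      (∀ (m : ℕ) (hm : m ∣ n) (v : HeightOneSpectrum (𝓞 K)), (m : 𝓞 K) ∉ v.asIdeal →
        (d m hm).kolyvaginClass hp M ∈ selmerLocalKer (W.baseChange K) (v.adicCompletion K) ((p ^ M : ℕ) : ℤ)) ∧
      -- Gross 5.4 (sign)
      (∀ (m : ℕ) (hm : m ∣ n),
        conjAct W c ((p ^ M : ℕ) : ℤ) ((d m hm).kolyvaginClass hp M) =
          (ε * (-1) ^ m.primeFactors.card) • (d m hm).kolyvaginClass hp M) ∧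
      -- McCallum 4.4 (key relation)
      (∀ (m : ℕ) (hm : m ∣ n) (ℓ : ℕ) (hℓ : ℓ ∈ m.primeFactors) (v : HeightOneSpectrum (𝓞 K)),
        (ℓ : 𝓞 K) ∈ v.asIdeal → ∀ a : ℕ,
          (((p : ℤ) ^ a) • (d m hm).kolyvaginClass hp M ∈
              selmerLocalKer (W.baseChange K) (v.adicCompletion K) ((p ^ M : ℕ) : ℤ) ↔
            ((p : ℤ) ^ a) • (d (m / ℓ) ((Nat.div_dvd_of_dvd (Nat.dvd_of_mem_primeFactors hℓ)).trans hm)).kolyvaginClass hp M ∈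
              (W.baseChange K).torsionLocalKer (v.adicCompletion K) ((p ^ M : ℕ) : ℤ))) ∧
      -- Jetchev 4.9 (stringent) at every bad place over a prime outside `S`
      (∀ (m : ℕ) (hm : m ∣ n) (q : ℕ), q.Prime → q ∣ N → q ∉ S →
        ∀ (v : HeightOneSpectrum (𝓞 K)), ((q : ℕ) : 𝓞 K) ∈ v.asIdeal → (m : 𝓞 K) ∉ v.asIdeal →
          ¬ (W.baseChange K).HasGoodReductionAt v → ∀ (hn' : ((p ^ M : ℕ) : ℤ) ≠ 0),
          galoisCohomology.localization ((W.baseChange K).torsionGaloisModule ((p ^ M : ℕ) : ℤ)) (Sum.inr v) 1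
              ((d m hm).kolyvaginClass hp M) ∈
            stringentFamily W K hn' (Sum.inr v)) := by
  haveI : Fact p.Prime := ⟨hp⟩
  have hn0 : n ≠ 0 := hn.ne_zero
  have hguard : ∀ q ∈ n.primeFactors, ¬ q ∣ N ∧ (Ideal.span {(q : 𝓞 K)}).IsPrime :=
    fun q hq ↦ ⟨(hKol q hq).1.2.1, (hKol q hq).1.2.2.2.2.1⟩
  -- coherent data and the labels in datum form
  obtain ⟨d, hy, -, hcoh⟩ := exists_coherent_familyData_y_eq (W := W) hK ι hn (fun q hq ↦ (hguard q hq).2) ys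
  obtain ⟨hB4d, hB5d, hB3d⟩ := familyLabels_of_labelsAt (W := W) hn hguard ys hL d hy
  obtain ⟨hcopT, hrecQ⟩ := familyReceptacle_of_labelB6 (W := W) hK ι p hirr hn hguard ys hB6 d hy
  have hcop : IsCoprime ((p ^ M : ℕ) : ℤ) (W.torsionOrder : ℤ) := by
    rw [Nat.cast_pow]; exact hcopT.pow_left
  -- admissibility from `htor` (the prime factors of `m ∣ n` are Kolyvagin primes `≠ p`)
  have hA : ∀ (m : ℕ) (hm : m ∣ n), IsAdmissible (absoluteGaloisGroup K) (d m hm).pointsSubgroup ((p ^ M : ℕ) : ℤ) := by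
    intro m hm
    have hm0 : m ≠ 0 := ne_zero_of_dvd_ne_zero hn0 hm
    have hpm : ¬ p ∣ m := fun h ↦ (hKol p (Nat.primeFactors_mono hm hn0 (Nat.mem_primeFactors.mpr ⟨hp, h, hm0⟩))).1.2.2.2.1 rfl
    exact isAdmissible_pointsSubgroup_familyData hK (d m hm) (htor m hm0 hpm)
  -- the receptacle indexed by the primes outside `S`
  have hrec : ∀ (q : ℕ), q.Prime → q ∣ N → q ∉ S → ∀ (m : ℕ) (hm : m ∣ n)
      (γ : ringClassField K ι m ≃ₐ[ℚ] ringClassField K ι m) (v : HeightOneSpectrum (𝓞 K)),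
      ((q : ℕ) : 𝓞 K) ∈ v.asIdeal →
        (W.torsionOrder : ℤ) • pointsMap (W.baseChange K) (v.adicCompletion K)
            ((d m hm).toGeomPoints (pointGalHom W (ringClassField K ι m) γ (d m hm).y)) ∈
          E0Receptacle (W.baseChange K) v ∧
        ∀ (ℓ : ℕ) (hℓ : ℓ ∈ m.primeFactors)
          (hle : ringClassField K ι (m / ℓ) ≤ ringClassField K ι m),
          (W.torsionOrder : ℤ) • pointsMap (W.baseChange K) (v.adicCompletion K)
              ((d m hm).toGeomPoints (pointGalHom W (ringClassField K ι m) γ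
                (WeierstrassCurve.Affine.Point.map (W' := W)
                  ((RingClassField.inclusion ι hle).restrictScalars ℚ)
                  (d (m / ℓ) ((Nat.div_dvd_of_dvd (Nat.dvd_of_mem_primeFactors hℓ)).trans hm)).y))) ∈
            E0Receptacle (W.baseChange K) v := by
    intro q hqp hqN hqS m hm γ v hqv
    have hqQ : q ∈ N.primeFactors.filter (· ∉ S) :=
      Finset.mem_filter.mpr ⟨Nat.mem_primeFactors.mpr ⟨hqp, hqN, NeZero.ne N⟩, hqS⟩
    exact hrecQ q hqQ hqp hqN (hsp q hqp hqN hqS) m hm γ v hqv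
  refine ⟨d, hA, hy, ?_, ?_, ?_, ?_⟩
  · exact kolyvaginClass_familyData_mem_selmerLocalKer hK ι hN hp hM Dt hin hn hKol d hB4d hcop hrec hA
  · exact conjAct_kolyvaginClass_familyData_eq_sign_smul hK ι hp hM Dt hn hKol d hc ε hB4d hB3d hA
  · exact keyRelation_familyData_of_labels hK ι hN hp hp2 hM Dt hn hKol d hcoh hB4d hB5d hA
  · intro m hm q hqp hqN hqS v hqv hmv hbad hn'
    haveI : Fact q.Prime := ⟨hqp⟩
    exact localization_kolyvaginClass_familyData_mem_stringentFamily hK ι hp hM hn' Dt hn hKol d hB4d hA hm q hqN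
      (hsp q hqp hqN hqS) v hqv hmv hbad hcop (fun γ ↦ hrec q hqp hqN hqS m hm γ v hqv)

end Summit.BirchSwinnertonDyer.BirchSwinnertonDyer.Theorems.ShimuraWalk

end
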